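import Literature.MathematicalPhysics.QuantumLattice.GrassmannChargeScaling
import Literature.MathematicalPhysics.QuantumLattice.HubbardEffectiveActionCT

/-!
# Crux `SeededBrokenRegimeBoseFermiPinned` (stmt-HubbardSuperconductivity-14047), line `seed-strength-flow`:
# global `U(1)` × seed covariance of the countertermed effective action (stub `stub_chargeSeedCovariance`, S9)

Support file (`--supports stmt-HubbardSuperconductivity-14047`).  The charge scaling of the Hubbard fields
`ψ⁺ ↦ z ψ⁺`, `ψ⁻ ↦ z⁻¹ ψ⁻` (`z ≠ 0`; `z = e^{iα}` is the global `U(1)` rotation of Benfatto–Giuliani–Mastropietro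
2006, §2.1, symmetry (2)) is the algebra homomorphism
`S_z := ExteriorAlgebra.map (LinearMap.mulLeft ℂ (fun X => if X.2 = 0 then z else z⁻¹))` of the Hubbard Grassmann
algebra.  The interaction slot `V_K = hubbardInteractionCT L M β U K` (Hubbard vertex `ψ⁺ψ⁻ψ⁺ψ⁻` plus the quadratic
counterterm `ψ⁺ψ⁻`) is CHARGE CONSERVING, hence `S_z`-invariant (`map_chargeScale_hubbardInteractionCT`); the seed
`h` sits only in the covariance.  By the generic covariance of Salmhofer's `Δ_C` calculus under charge scalings
(`effAction_map_mulLeft`, `GrassmannChargeScaling.lean`) the scaled effective action is therefore the effective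
action, for the SAME interaction, of the entrywise rescaled covariance
`(X, Y) ↦ w(X) w(Y) C^{K,>Λ}_h(X, Y)`, `w(ψ⁺) = z⁻¹`, `w(ψ⁻) = z`: the normal (`ψ⁻ψ⁺`) entries are unchanged and the
anomalous `ψ⁺ψ⁺` / `ψ⁻ψ⁻` blocks — the only place the seed enters — are multiplied by `z⁻²` / `z²`, i.e. the real
seed `h` becomes the complex pair `(h z⁻², h z²)`.  This is the rotation identity of the sibling card
`rotation-identity-goldstone-pin` "verbatim for every cutoff Grassmann integral" (interaction, frame `e_K` and
Salmhofer's cutoff weight are functions of the invariants only), the Grassmann-level Ward identity that pins the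
transverse pair mass scale by scale; its two in-family instances are seed parity (`z = i`: `h ↦ −h`) and the `U(1)`
invariance at `h = 0` (stubs S10a, S10b of the line).
-/

set_option linter.dupNamespace false -- `Summit.<S>.<S>` doubles the summit name (tree convention)

namespace Summit.HubbardSuperconductivity.HubbardSuperconductivity.Theorems.AposterioriCapRgSeededBrokenRegimeBoseFermiPinned

open Literature.MathematicalPhysics.QuantumLattice Literature.Probability.LatticeModels GrassmannAlgebra

variable {L M : ℕ}

/-- The charge weights `w_z(ψ⁺) = z`, `w_z(ψ⁻) = z⁻¹` and `w_{z⁻¹}` are reciprocal: `w_{z⁻¹} · w_z = 1` (`z ≠ 0`).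
[folklore] -/
theorem chargeWeight_inv_mul {z : ℂ} (hz : z ≠ 0) :
    (fun X : HubbardFieldIdx L M => if X.2 = 0 then z⁻¹ else z) *
        (fun X : HubbardFieldIdx L M => if X.2 = 0 then z else z⁻¹) = 1 := by
  funext X
  simp only [Pi.mul_apply, Pi.one_apply]
  split_ifs <;> field_simp

/-- Pointwise: `w_z(X) · w_{z⁻¹}(X) = 1`. [folklore] -/
theorem chargeWeight_mul_inv_apply {z : ℂ} (hz : z ≠ 0) (X : HubbardFieldIdx L M) :
    (if X.2 = 0 then z else z⁻¹) * (if X.2 = 0 then z⁻¹ else z) = 1 := by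
  split_ifs <;> field_simp

/-- The charge scaling multiplies `ψ⁺_{kσ}` by `z`. [folklore] -/
theorem map_chargeScale_psiPlus (z : ℂ) (k : FreqMomentum L M) (σ : Fin 2) :
    ExteriorAlgebra.map (LinearMap.mulLeft ℂ (fun X : HubbardFieldIdx L M => if X.2 = 0 then z else z⁻¹))
        (psiPlus k σ) = z • psiPlus k σ := by
  rw [psiPlus, map_mulLeft_gen]
  simp

/-- The charge scaling multiplies `ψ⁻_{kσ}` by `z⁻¹`. [folklore] -/
theorem map_chargeScale_psiMinus (z : ℂ) (k : FreqMomentum L M) (σ : Fin 2) :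
    ExteriorAlgebra.map (LinearMap.mulLeft ℂ (fun X : HubbardFieldIdx L M => if X.2 = 0 then z else z⁻¹))
        (psiMinus k σ) = z⁻¹ • psiMinus k σ := by
  rw [psiMinus, map_mulLeft_gen]
  simp

/-- A charge-conserving quartic monomial is invariant: `(zψ⁺)(z⁻¹ψ⁻)(zψ⁺)(z⁻¹ψ⁻) = ψ⁺ψ⁻ψ⁺ψ⁻`. [folklore] -/
theorem chargeScale_quartic_monomial {z : ℂ} (hz : z ≠ 0) (a b c d : HubbardGrassmann L M) :
    (z • a) * (z⁻¹ • b) * (z • c) * (z⁻¹ • d) = a * b * c * d := by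
  rw [smul_mul_smul_comm, smul_mul_smul_comm, smul_mul_smul_comm]
  rw [show z * z⁻¹ * z * z⁻¹ = 1 by field_simp, one_smul]

/-- A charge-conserving quadratic monomial is invariant: `(zψ⁺)(z⁻¹ψ⁻) = ψ⁺ψ⁻`. [folklore] -/
theorem chargeScale_quadratic_monomial {z : ℂ} (hz : z ≠ 0) (a b : HubbardGrassmann L M) :
    (z • a) * (z⁻¹ • b) = a * b := by
  rw [smul_mul_smul_comm, mul_inv_cancel₀ hz, one_smul]

variable (L M) [NeZero L]

/-- **The Hubbard vertex is `U(1)`-invariant**: `S_z V = V` (BGM 2006 §2.1: "both the Gaussian integration and the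
interaction are invariant under … global `U(1)`"). [folklore] -/
theorem map_chargeScale_hubbardInteraction {z : ℂ} (hz : z ≠ 0) (β U : ℝ) :
    ExteriorAlgebra.map (LinearMap.mulLeft ℂ (fun X : HubbardFieldIdx L M => if X.2 = 0 then z else z⁻¹))
        (hubbardInteraction L M β U) = hubbardInteraction L M β U := by
  rw [hubbardInteraction, map_smul]
  congr 1
  rw [map_sum]
  refine Finset.sum_congr rfl fun k₁ _ => ?_
  rw [map_sum]
  refine Finset.sum_congr rfl fun k₂ _ => ?_
  rw [map_sum]
  refine Finset.sum_congr rfl fun k₃ _ => ?_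
  rw [map_sum]
  refine Finset.sum_congr rfl fun k₄ _ => ?_
  split_ifs
  · rw [map_mul, map_mul, map_mul, map_chargeScale_psiPlus, map_chargeScale_psiMinus, map_chargeScale_psiPlus,
      map_chargeScale_psiMinus, chargeScale_quartic_monomial hz]
  · exact map_zero _

/-- **The quadratic counterterm is `U(1)`-invariant**: `S_z 𝒩_K = 𝒩_K`. [folklore] -/
theorem map_chargeScale_counterQuadratic {z : ℂ} (hz : z ≠ 0) (β : ℝ) (K : TrigPolyC4v) :
    ExteriorAlgebra.map (LinearMap.mulLeft ℂ (fun X : HubbardFieldIdx L M => if X.2 = 0 then z else z⁻¹))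
        (counterQuadratic L M β K) = counterQuadratic L M β K := by
  rw [counterQuadratic, map_sum]
  refine Finset.sum_congr rfl fun k _ => ?_
  rw [map_sum]
  refine Finset.sum_congr rfl fun σ _ => ?_
  rw [map_smul, map_mul, map_chargeScale_psiPlus, map_chargeScale_psiMinus, chargeScale_quadratic_monomial hz]

/-- **The interaction in the frame `K` is `U(1)`-invariant**: `S_z V_K = V_K`. [folklore] -/
theorem map_chargeScale_hubbardInteractionCT {z : ℂ} (hz : z ≠ 0) (β U : ℝ) (K : TrigPolyC4v) :
    ExteriorAlgebra.map (LinearMap.mulLeft ℂ (fun X : HubbardFieldIdx L M => if X.2 = 0 then z else z⁻¹))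
        (hubbardInteractionCT L M β U K) = hubbardInteractionCT L M β U K := by
  rw [hubbardInteractionCT, map_add, map_chargeScale_hubbardInteraction L M hz, map_chargeScale_counterQuadratic L M hz]

/-- **S9 (`ChargeSeedCovariance`)**, the global `U(1)` × seed covariance of the countertermed effective action at
the Grassmann level: for every `z ≠ 0` the charge scaling `ψ⁺ ↦ z ψ⁺`, `ψ⁻ ↦ z⁻¹ ψ⁻` maps
`𝒢^K_Λ(h) = hubbardEffectiveActionCT L M β U μ h K Λ` to the effective action, for the same interaction `V_K`, of
the entrywise rescaled covariance `(X, Y) ↦ w(X) w(Y) C^{K,>Λ}_h(X, Y)` with `w(ψ⁺) = z⁻¹`, `w(ψ⁻) = z` (normal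
entries unchanged, anomalous `ψ⁺ψ⁺` / `ψ⁻ψ⁻` blocks multiplied by `z⁻²` / `z²`: the complex-seed family).  Proof:
`effAction_map_mulLeft` for the reciprocal weights `w_{z⁻¹} · w_z = 1` applied to the rescaled covariance, whose
double rescaling is the original one, and the `U(1)` invariance of `V_K`.
[cite: BenfattoGiulianiMastropietro2006, §2.1 (symmetry (2))] -/
theorem stub_chargeSeedCovariance :
    ∀ (L M : ℕ) [NeZero L] (β U μ h : ℝ) (K : TrigPolyC4v) (Λ : ℝ) (z : ℂ), z ≠ 0 →
      ExteriorAlgebra.map (LinearMap.mulLeft ℂ (fun X : HubbardFieldIdx L M => if X.2 = 0 then z else z⁻¹))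
          (hubbardEffectiveActionCT L M β U μ h K Λ) =
        effAction ℂ
          (Matrix.of fun X Y : HubbardFieldIdx L M =>
            (if X.2 = 0 then z⁻¹ else z) * (if Y.2 = 0 then z⁻¹ else z) * hubbardCovAboveCT L M β μ h K Λ X Y)
          (hubbardInteractionCT L M β U K) := by
  intro L M _ β U μ h K Λ z hz
  set C₀ : Matrix (HubbardFieldIdx L M) (HubbardFieldIdx L M) ℂ := Matrix.of fun X Y : HubbardFieldIdx L M =>
    (if X.2 = 0 then z⁻¹ else z) * (if Y.2 = 0 then z⁻¹ else z) * hubbardCovAboveCT L M β μ h K Λ X Y with hC₀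
  have key := effAction_map_mulLeft ℂ (chargeWeight_inv_mul (L := L) (M := M) hz) C₀ (hubbardInteractionCT L M β U K)
  have hCC : (Matrix.of fun X Y : HubbardFieldIdx L M =>
      (if X.2 = 0 then z else z⁻¹) * (if Y.2 = 0 then z else z⁻¹) * C₀ X Y) = hubbardCovAboveCT L M β μ h K Λ := by
    ext X Y
    simp only [hC₀, Matrix.of_apply]
    calc (if X.2 = 0 then z else z⁻¹) * (if Y.2 = 0 then z else z⁻¹) *
          ((if X.2 = 0 then z⁻¹ else z) * (if Y.2 = 0 then z⁻¹ else z) * hubbardCovAboveCT L M β μ h K Λ X Y)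
        = ((if X.2 = 0 then z else z⁻¹) * (if X.2 = 0 then z⁻¹ else z)) *
            ((if Y.2 = 0 then z else z⁻¹) * (if Y.2 = 0 then z⁻¹ else z)) * hubbardCovAboveCT L M β μ h K Λ X Y := by
          ring
      _ = hubbardCovAboveCT L M β μ h K Λ X Y := by
          rw [chargeWeight_mul_inv_apply hz, chargeWeight_mul_inv_apply hz, one_mul, one_mul]
  rw [map_chargeScale_hubbardInteractionCT L M hz, hCC] at key
  rw [hubbardEffectiveActionCT_def, key]

end Summit.HubbardSuperconductivity.HubbardSuperconductivity.Theorems.AposterioriCapRgSeededBrokenRegimeBoseFermiPinned
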